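import Mathlib
import Summits.ValiantsHypothesis.ValiantsHypothesis.Theorems.MonotoneRestorationOrbitRestorationQPRowColumnTwoLevel
import Summits.ValiantsHypothesis.ValiantsHypothesis.Theorems.MonotoneRestorationOrbitRestorationQPMultisymmetricPowerSums
import HarnessLib

/-!
# The multi-statistic row/column stratum of A_∞ is orbit-restorable (ORBIT currency)

Route MonotoneRestoration, crux `OrbitRestorationQP` (stmt-ValiantsHypothesis-18293), line `depth-three-rung`, registered stub
`stub_sigmaPiSigmaValue` (A_∞).  Namespace `Summit.ValiantsHypothesis.ValiantsHypothesis.Theorems.RowColumnMultiLevel`.  Definition-free.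

`Theorems/…RowColumnTwoLevel.lean` restores the matrix-symmetric elements of `ℂ[g(row_i), g'(col_j)]` for ONE symmetric statistic
per row and per column.  With the first fundamental theorem for multisymmetric polynomials
(`Theorems/…MultisymmetricPowerSums.lean`, `mem_adjoin_powerSums_of_rowSymmetric`) the same pipeline handles ANY FINITE FAMILIES of
symmetric statistics `g_k` (`k ∈ κ`) of the rows and `g'_l` (`l ∈ κ'`) of the columns — the «d-family row/column-separable
statistics stratum» of the repair census of hand -4 g2:

* `mem_adjoin_polarized_of_symmetric` — **MULTI ONE-BLOCK SYMMETRISATION**: if `p ∈ ℂ[s₀ ∪ {v_{jk}}]` and algebra endomorphisms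
  `ρ_τ` (`τ ∈ Sym_n`) fix `s₀` pointwise, act by `ρ_τ v_{jk} = v_{τ j, k}` and fix `p`, then
  `p ∈ ℂ[s₀ ∪ {Σ_j Π_k v_{jk}^{α_k} : α ∈ ℕ^κ}]` (average a representation over `Sym_n` inside `B[y_{jk}]`, `B = ℂ[s₀]`, and
  apply the multisymmetric fundamental theorem over the ring `B`);
* `prodPowerSum_qpOrbitRestorable`, `colProdPowerSum_qpOrbitRestorable` — the polarized power sums `Σ_i Π_k v_{ik}^{α_k}` of an
  equivariant row-local (column-local) family are `QPOrbitRestorable 9 n` (`RowColumnTwoLevel.twoLevel_powerSum_qpOrbitRestorable`);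
* `qpOrbitRestorable_multiLevel` — **THE MULTI-STATISTIC ROW/COLUMN STRATUM**: for symmetric `g_k, g'_l ∈ ℂ[y_0, …, y_{n-1}]`
  every MATRIX-SYMMETRIC element of `ℂ[g_k(row_i), g'_l(col_j) : i, j < n, k ∈ κ, l ∈ κ']` is `QPOrbitRestorable 12 n`
  (the representation may be completely asymmetric; `κ, κ'` arbitrary finite index types).

Calibration: unconditional, VH-free; contains the two-level stratum (`|κ| = |κ'| = 1`) and hence `ℂ[r, c]`; e.g. every
matrix-symmetric polynomial in all the row power sums `Σ_j x_ij^m` and column power sums `Σ_i x_ij^m` (`m ≤ M`) is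
`QPOrbitRestorable 12 n`.  Nothing here bears on VP ≠ VNP. [folklore]
[cite: Weyl1939, Chap. II §3, Thm (2.3.A); DawarWilsenach2025, §3.3]

## References
* H. Weyl, *The Classical Groups*, Princeton (1939), Chap. II §3, Theorem (2.3.A). [Weyl1939]
* A. Dawar, G. Wilsenach, *Symmetric arithmetic circuits*, ToC 21 (2025), §3.3. [DawarWilsenach2025]
-/

noncomputable section

open scoped Classical

-- `Summit.ValiantsHypothesis.ValiantsHypothesis.…` is the tree's single-conjunct layout (Sub = Summit).
set_option linter.dupNamespace false

namespace Summit.ValiantsHypothesis.ValiantsHypothesis.Theorems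

namespace RowColumnMultiLevel

open MvPolynomial Equiv Literature.Computability.AlgebraicComplexity OrbitRestorationQPDepthThreeRung

variable {n : ℕ}

/-! ### Multi one-block symmetrisation -/

/-- **MULTI ONE-BLOCK SYMMETRISATION.**  Let `s₀` be a set of polynomials, `v_{jk}` (`j < n`, `k ∈ κ`) further polynomials, and
`ρ_τ` (`τ ∈ Sym_n`) algebra endomorphisms fixing `s₀` pointwise with `ρ_τ v_{jk} = v_{τ j, k}`.  If `p ∈ ℂ[s₀ ∪ {v_{jk}}]` is fixed
by every `ρ_τ`, then `p ∈ ℂ[s₀ ∪ {Σ_j Π_k v_{jk}^{α_k} : α}]`. [cite: Weyl1939, Chap. II §3, Thm (2.3.A)] -/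
theorem mem_adjoin_polarized_of_symmetric {κ : Type*} [Fintype κ] (s₀ : Set (MvPolynomial (Fin n × Fin n) ℂ))
    (v : Fin n × κ → MvPolynomial (Fin n × Fin n) ℂ)
    (ρ : Perm (Fin n) → (MvPolynomial (Fin n × Fin n) ℂ →ₐ[ℂ] MvPolynomial (Fin n × Fin n) ℂ))
    (hρs : ∀ τ, ∀ x ∈ s₀, ρ τ x = x) (hρv : ∀ τ q, ρ τ (v q) = v (τ q.1, q.2))
    {p : MvPolynomial (Fin n × Fin n) ℂ} (hρp : ∀ τ, ρ τ p = p)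
    (hp : p ∈ Algebra.adjoin ℂ (s₀ ∪ Set.range v)) :
    p ∈ Algebra.adjoin ℂ (s₀ ∪ Set.range fun α : κ → ℕ => ∑ j : Fin n, ∏ k : κ, v (j, k) ^ α k) := by
  set B : Subalgebra ℂ (MvPolynomial (Fin n × Fin n) ℂ) := Algebra.adjoin ℂ s₀ with hBdef
  -- Step 1: a representation `p = aeval v F` with `F ∈ B[y_{jk}]`
  have hp' : p ∈ Algebra.adjoin B (Set.range v) := by
    have h := hp
    rw [Algebra.adjoin_union_eq_adjoin_adjoin] at h
    exact (Subalgebra.mem_restrictScalars ℂ).1 h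
  rw [Algebra.adjoin_range_eq_range_aeval, AlgHom.mem_range] at hp'
  obtain ⟨F, hF⟩ := hp'
  -- Step 2: `ρ τ` fixes `B` pointwise, hence `ρ τ (aeval v F) = aeval v (rename τ F)`
  have hρB : ∀ (τ : Perm (Fin n)) (b : B), ρ τ (b : MvPolynomial (Fin n × Fin n) ℂ) = b := by
    intro τ b
    have hle : B ≤ AlgHom.equalizer (ρ τ) (AlgHom.id ℂ (MvPolynomial (Fin n × Fin n) ℂ)) := by
      rw [hBdef]
      exact Algebra.adjoin_le fun x hx => (AlgHom.mem_equalizer _ _ x).2 (by rw [AlgHom.id_apply]; exact hρs τ x hx)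
    have := (AlgHom.mem_equalizer _ _ _).1 (hle b.2)
    rwa [AlgHom.id_apply] at this
  have hρF : ∀ τ : Perm (Fin n), ρ τ (aeval v F) = aeval v (rename (fun w : Fin n × κ => (τ w.1, w.2)) F) := by
    intro τ
    let ρ' : MvPolynomial (Fin n × Fin n) ℂ →ₐ[B] MvPolynomial (Fin n × Fin n) ℂ :=
      { (ρ τ).toRingHom with
        commutes' := fun b => by
          change ρ τ (algebraMap B (MvPolynomial (Fin n × Fin n) ℂ) b) = algebraMap B _ b
          rw [Subalgebra.algebraMap_def, Algebra.algebraMap_self, RingHom.id_apply]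
          exact hρB τ b }
    have hρ' : ∀ x, ρ' x = ρ τ x := fun _ => rfl
    have hc := AlgHom.congr_fun (MvPolynomial.comp_aeval (f := v) ρ') F
    rw [AlgHom.comp_apply, hρ'] at hc
    have hfg : (fun q => ρ' (v q)) = v ∘ fun w : Fin n × κ => (τ w.1, w.2) :=
      funext fun q => by rw [Function.comp_apply, hρ', hρv]
    rw [hc, aeval_rename, hfg]
  -- Step 3: averaging over `Sym_n`
  set N : ℕ := Fintype.card (Perm (Fin n)) with hNdef
  have hN : (N : ℂ) ≠ 0 := Nat.cast_ne_zero.2 Fintype.card_ne_zero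
  have hsum : aeval v (∑ τ : Perm (Fin n), rename (fun w : Fin n × κ => (τ w.1, w.2)) F) = (N : ℂ) • p := by
    rw [map_sum]
    have : ∀ τ : Perm (Fin n), aeval v (rename (fun w : Fin n × κ => (τ w.1, w.2)) F) = p := fun τ => by
      rw [← hρF, hF, hρp]
    simp only [this, Finset.sum_const, Finset.card_univ, hNdef]
    exact (Nat.cast_smul_eq_nsmul ℂ _ p).symm
  set G : MvPolynomial (Fin n × κ) B :=
    C (algebraMap ℂ B ((N : ℂ)⁻¹)) * ∑ τ : Perm (Fin n), rename (fun w : Fin n × κ => (τ w.1, w.2)) F with hGdef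
  have hG : aeval v G = p := by
    rw [hGdef, map_mul, aeval_C, hsum, ← IsScalarTower.algebraMap_apply, MvPolynomial.algebraMap_eq, smul_eq_C_mul,
      ← mul_assoc, ← map_mul, inv_mul_cancel₀ hN, C_1, one_mul]
  have hGsym : ∀ τ' : Perm (Fin n), rename (fun w : Fin n × κ => (τ' w.1, w.2)) G = G := by
    intro τ'
    rw [hGdef, map_mul, rename_C, map_sum]
    congr 1
    simp only [rename_rename]
    have hmul : ∀ τ : Perm (Fin n), ((fun w : Fin n × κ => (τ' w.1, w.2)) ∘ fun w : Fin n × κ => (τ w.1, w.2)) =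
        fun w : Fin n × κ => ((τ' * τ) w.1, w.2) := fun τ => funext fun w => by simp [Perm.mul_apply]
    simp only [hmul]
    exact Fintype.sum_equiv (Equiv.mulLeft τ') _ _ (fun τ => rfl)
  -- Step 4: the multisymmetric fundamental theorem over `B`
  have hGmem := MultisymmetricPowerSums.mem_adjoin_powerSums_of_rowSymmetric ℂ G hGsym
  have hpB : p ∈ (Algebra.adjoin B (Set.range fun α : κ → ℕ =>
      ∑ i : Fin n, ∏ k : κ, (X (i, k) : MvPolynomial (Fin n × κ) B) ^ α k)).map (aeval v) :=
    Subalgebra.mem_map.2 ⟨G, hGmem, hG⟩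
  rw [AlgHom.map_adjoin, ← Set.range_comp] at hpB
  have hfun : ((aeval v : MvPolynomial (Fin n × κ) B →ₐ[B] MvPolynomial (Fin n × Fin n) ℂ) ∘ fun α : κ → ℕ =>
      ∑ i : Fin n, ∏ k : κ, (X (i, k) : MvPolynomial (Fin n × κ) B) ^ α k) =
      fun α : κ → ℕ => ∑ j : Fin n, ∏ k : κ, v (j, k) ^ α k := by
    funext α
    simp only [Function.comp_apply, map_sum, map_prod, map_pow, aeval_X]
  rw [hfun] at hpB
  rw [Algebra.adjoin_union_eq_adjoin_adjoin]
  exact (Subalgebra.mem_restrictScalars ℂ).2 hpB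

/-! ### Polarized power sums of equivariant row-local / column-local families -/

/-- **Polarized power sums of an equivariant row-local family are restorable.**  If `σ · v_{ik} = v_{σ i, k}` and every `v_{ik}` is
a polynomial in the power sums `Σ_j x_ij^m` of row `i`, then every `Σ_i Π_k v_{ik}^{α_k}` is `QPOrbitRestorable 9 n`. [folklore] -/
theorem prodPowerSum_qpOrbitRestorable {κ : Type*} [Fintype κ] (v : Fin n × κ → MvPolynomial (Fin n × Fin n) ℂ)
    (hv : ∀ (σ : Perm (Fin n)) (i : Fin n) (k : κ), ren σ (v (i, k)) = v (σ i, k))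
    (hmem : ∀ (i : Fin n) (k : κ), v (i, k) ∈
      Algebra.adjoin ℂ (Set.range fun m : ℕ => ∑ j : Fin n, (X (i, j) : MvPolynomial (Fin n × Fin n) ℂ) ^ m))
    (α : κ → ℕ) : QPOrbitRestorable 9 n (∑ i : Fin n, ∏ k : κ, v (i, k) ^ α k) := by
  have h := RowColumnTwoLevel.twoLevel_powerSum_qpOrbitRestorable (fun i : Fin n => ∏ k : κ, v (i, k) ^ α k)
    (fun σ i => by simp only [map_prod, map_pow, hv])
    (fun i => Subalgebra.prod_mem _ fun k _ => Subalgebra.pow_mem _ (hmem i k) _) 1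
  simpa only [pow_one] using h

/-- The column version. [folklore] -/
theorem colProdPowerSum_qpOrbitRestorable {κ : Type*} [Fintype κ] (w : Fin n × κ → MvPolynomial (Fin n × Fin n) ℂ)
    (hw : ∀ (σ : Perm (Fin n)) (j : Fin n) (k : κ), ren σ (w (j, k)) = w (σ j, k))
    (hmem : ∀ (j : Fin n) (k : κ), w (j, k) ∈
      Algebra.adjoin ℂ (Set.range fun m : ℕ => ∑ i : Fin n, (X (i, j) : MvPolynomial (Fin n × Fin n) ℂ) ^ m))
    (α : κ → ℕ) : QPOrbitRestorable 9 n (∑ j : Fin n, ∏ k : κ, w (j, k) ^ α k) := by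
  have h := RowColumnTwoLevel.twoLevel_colPowerSum_qpOrbitRestorable (fun j : Fin n => ∏ k : κ, w (j, k) ^ α k)
    (fun σ j => by simp only [map_prod, map_pow, hw])
    (fun j => Subalgebra.prod_mem _ fun k _ => Subalgebra.pow_mem _ (hmem j k) _) 1
  simpa only [pow_one] using h

/-! ### The multi-statistic row/column stratum -/

/-- **THE MULTI-STATISTIC ROW/COLUMN STRATUM.**  For finite families of symmetric polynomials `g_k, g'_l ∈ ℂ[y_0, …, y_{n-1}]`
put `v_{ik} = g_k(x_i0, …, x_i,n-1)` (row `i`) and `w_{jl} = g'_l(x_0j, …, x_n-1,j)` (column `j`).  Every MATRIX-SYMMETRIC element of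
`ℂ[v_{ik}, w_{jl} : i, j < n, k ∈ κ, l ∈ κ']` is `QPOrbitRestorable 12 n`. [folklore] -/
theorem qpOrbitRestorable_multiLevel {κ κ' : Type*} [Fintype κ] [Fintype κ']
    (g : κ → MvPolynomial (Fin n) ℂ) (g' : κ' → MvPolynomial (Fin n) ℂ)
    (hg : ∀ k, (g k).IsSymmetric) (hg' : ∀ l, (g' l).IsSymmetric)
    {p : MvPolynomial (Fin n × Fin n) ℂ}
    (hsym : ∀ σ τ : Perm (Fin n), rename (fun q : Fin n × Fin n => (σ q.1, τ q.2)) p = p)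
    (hp : p ∈ Algebra.adjoin ℂ
      (Set.range (fun q : Fin n × κ => aeval (fun j : Fin n => (X (q.1, j) : MvPolynomial (Fin n × Fin n) ℂ)) (g q.2)) ∪
        Set.range (fun q : Fin n × κ' => aeval (fun i : Fin n => (X (i, q.1) : MvPolynomial (Fin n × Fin n) ℂ)) (g' q.2)))) :
    QPOrbitRestorable 12 n p := by
  set v : Fin n × κ → MvPolynomial (Fin n × Fin n) ℂ :=
    fun q => aeval (fun j : Fin n => (X (q.1, j) : MvPolynomial (Fin n × Fin n) ℂ)) (g q.2) with hvdef
  set w : Fin n × κ' → MvPolynomial (Fin n × Fin n) ℂ :=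
    fun q => aeval (fun i : Fin n => (X (i, q.1) : MvPolynomial (Fin n × Fin n) ℂ)) (g' q.2) with hwdef
  -- behaviour under row / column / diagonal renaming
  have hv_col : ∀ (τ : Perm (Fin n)) (q : Fin n × κ), rename (fun P : Fin n × Fin n => (P.1, τ P.2)) (v q) = v q := by
    intro τ q
    simp only [hvdef, MvPolynomial.comp_aeval_apply, rename_X]
    exact RowColumnTwoLevel.aeval_perm_of_isSymmetric (hg q.2) (fun j => (X (q.1, j) : MvPolynomial (Fin n × Fin n) ℂ)) τ
  have hw_col : ∀ (τ : Perm (Fin n)) (q : Fin n × κ'),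
      rename (fun P : Fin n × Fin n => (P.1, τ P.2)) (w q) = w (τ q.1, q.2) :=
    fun τ q => by simp only [hwdef, MvPolynomial.comp_aeval_apply, rename_X]
  have hv_row : ∀ (σ : Perm (Fin n)) (q : Fin n × κ),
      rename (fun P : Fin n × Fin n => (σ P.1, P.2)) (v q) = v (σ q.1, q.2) :=
    fun σ q => by simp only [hvdef, MvPolynomial.comp_aeval_apply, rename_X]
  have hw_row : ∀ (σ : Perm (Fin n)) (q : Fin n × κ'), rename (fun P : Fin n × Fin n => (σ P.1, P.2)) (w q) = w q := by
    intro σ q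
    simp only [hwdef, MvPolynomial.comp_aeval_apply, rename_X]
    exact RowColumnTwoLevel.aeval_perm_of_isSymmetric (hg' q.2) (fun i => (X (i, q.1) : MvPolynomial (Fin n × Fin n) ℂ)) σ
  have hv_diag : ∀ (σ : Perm (Fin n)) (i : Fin n) (k : κ), ren σ (v (i, k)) = v (σ i, k) := by
    intro σ i k
    simp only [hvdef, MvPolynomial.comp_aeval_apply, ren_X, Prod.smul_mk, Perm.smul_def]
    exact RowColumnTwoLevel.aeval_perm_of_isSymmetric (hg k) (fun j => (X (σ i, j) : MvPolynomial (Fin n × Fin n) ℂ)) σ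
  have hw_diag : ∀ (σ : Perm (Fin n)) (j : Fin n) (l : κ'), ren σ (w (j, l)) = w (σ j, l) := by
    intro σ j l
    simp only [hwdef, MvPolynomial.comp_aeval_apply, ren_X, Prod.smul_mk, Perm.smul_def]
    exact RowColumnTwoLevel.aeval_perm_of_isSymmetric (hg' l) (fun i => (X (i, σ j) : MvPolynomial (Fin n × Fin n) ℂ)) σ
  -- Step 1: symmetrise the columns over `ℂ[v]`
  have h1 := mem_adjoin_polarized_of_symmetric (Set.range v) w
    (fun τ => rename (fun P : Fin n × Fin n => (P.1, τ P.2)))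
    (by rintro τ _ ⟨q, rfl⟩; exact hv_col τ q) (fun τ q => hw_col τ q)
    (fun τ => by simpa only [Perm.coe_one, id_eq] using hsym 1 τ) hp
  -- Step 2: symmetrise the rows over `ℂ[polarized power sums of w]`
  rw [Set.union_comm] at h1
  have h2 := mem_adjoin_polarized_of_symmetric
    (Set.range fun α : κ' → ℕ => ∑ j : Fin n, ∏ l : κ', w (j, l) ^ α l) v
    (fun σ => rename (fun P : Fin n × Fin n => (σ P.1, P.2)))
    (by
      rintro σ _ ⟨α, rfl⟩
      simp only [map_sum, map_prod, map_pow, hw_row])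
    (fun σ q => hv_row σ q)
    (fun σ => by simpa only [Perm.coe_one, id_eq] using hsym σ 1) h1
  -- Step 3: restorable generators; Step 4: flat-cost closure
  refine RowColumnRestorable.qpOrbitRestorable_of_mem_adjoin (c := 9)
    (T := (Set.range fun α : κ' → ℕ => ∑ j : Fin n, ∏ l : κ', w (j, l) ^ α l) ∪
      Set.range fun α : κ → ℕ => ∑ i : Fin n, ∏ k : κ, v (i, k) ^ α k) ?_ h2
  rintro t (⟨α, rfl⟩ | ⟨α, rfl⟩)
  · exact colProdPowerSum_qpOrbitRestorable w hw_diag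
      (fun j l => RowColumnTwoLevel.aeval_mem_adjoin_powerSums_of_isSymmetric
        (fun i : Fin n => (X (i, j) : MvPolynomial (Fin n × Fin n) ℂ)) (hg' l)) α
  · exact prodPowerSum_qpOrbitRestorable v hv_diag
      (fun i k => RowColumnTwoLevel.aeval_mem_adjoin_powerSums_of_isSymmetric
        (fun j : Fin n => (X (i, j) : MvPolynomial (Fin n × Fin n) ℂ)) (hg k)) α

/-- **Example: all row and column power sums.**  Every matrix-symmetric polynomial in the row power sums `Σ_j x_ij^{m+1}` and the
column power sums `Σ_i x_ij^{m+1}` (`m < M`) is `QPOrbitRestorable 12 n`. [folklore] -/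
theorem qpOrbitRestorable_of_mem_adjoin_rowcol_powerSums (M : ℕ) {p : MvPolynomial (Fin n × Fin n) ℂ}
    (hsym : ∀ σ τ : Perm (Fin n), rename (fun q : Fin n × Fin n => (σ q.1, τ q.2)) p = p)
    (hp : p ∈ Algebra.adjoin ℂ
      (Set.range (fun q : Fin n × Fin M => ∑ j : Fin n, (X (q.1, j) : MvPolynomial (Fin n × Fin n) ℂ) ^ ((q.2 : ℕ) + 1)) ∪
        Set.range (fun q : Fin n × Fin M => ∑ i : Fin n, (X (i, q.1) : MvPolynomial (Fin n × Fin n) ℂ) ^ ((q.2 : ℕ) + 1)))) :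
    QPOrbitRestorable 12 n p := by
  refine qpOrbitRestorable_multiLevel (fun m : Fin M => psum (Fin n) ℂ ((m : ℕ) + 1))
    (fun m : Fin M => psum (Fin n) ℂ ((m : ℕ) + 1)) (fun m => psum_isSymmetric _ _ _) (fun m => psum_isSymmetric _ _ _)
    hsym ?_
  have hv : (fun q : Fin n × Fin M =>
      aeval (fun j : Fin n => (X (q.1, j) : MvPolynomial (Fin n × Fin n) ℂ)) (psum (Fin n) ℂ ((q.2 : ℕ) + 1))) =
      fun q : Fin n × Fin M => ∑ j : Fin n, (X (q.1, j) : MvPolynomial (Fin n × Fin n) ℂ) ^ ((q.2 : ℕ) + 1) := by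
    funext q
    simp only [psum, map_sum, map_pow, aeval_X]
  have hw : (fun q : Fin n × Fin M =>
      aeval (fun i : Fin n => (X (i, q.1) : MvPolynomial (Fin n × Fin n) ℂ)) (psum (Fin n) ℂ ((q.2 : ℕ) + 1))) =
      fun q : Fin n × Fin M => ∑ i : Fin n, (X (i, q.1) : MvPolynomial (Fin n × Fin n) ℂ) ^ ((q.2 : ℕ) + 1) := by
    funext q
    simp only [psum, map_sum, map_pow, aeval_X]
  rw [hv, hw]
  exact hp

end RowColumnMultiLevel

end Summit.ValiantsHypothesis.ValiantsHypothesis.Theorems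

end
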